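import Mathlib
import HarnessLib
import HarnessLib.Audit
import Summits.HubbardSuperconductivity.Statement
import Literature.MathematicalPhysics.QuantumLattice.PairFieldEvenSideLRO
import Literature.MathematicalPhysics.QuantumLattice.LocalPairOn

/-!
Route: WidthHaldane

DORMANT since 2026-09-03T16:18:32Z (reconciler: no traction for 5 d (last activity statement-checked at 2026-08-29T15:23:39Z); parked, not closed — `ledger route dormant route-HubbardSuperconductivity-WidthHaldane --off` to reactivate) — unstaffed, not closed; items shared with open routes are served there. `ledger route dormant <id> --off` reactivates.

# Route WidthHaldane — Haldane's relation climbs the width — d-wave LRO as the diagonal of a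
width-uniform family of Luther–Emery power laws

STRENGTHEN lens (inventor's paradox). Replace the summit S by the STRONGER, more structured
statement S⁺ = `TubeFamilyLaw`: put the PURE model (t = 1, t' = 0, repulsive U) on EVERY even tube
Λ_{L,M} = (ℤ/Lℤ)×(ℤ/Mℤ), 2 ≤ M ≤ L (typed, since rev 5, over EVERY linearly ordered labelling e : Λ
≃ ℤ/L × ℤ/M of the sites — all labellings are unitarily equivalent, the Jordan–Wigner order is
immaterial — nearest-neighbour graph G_e, `hamiltonian G_e 1 U`), in the (N_{L,M} = 2⌊(1−δ)LM/2⌋,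
S^z = 0) sector, and read the COLUMN d_{x²−y²} pair field Φ_a = Σ_{b} P_{(a,b)} (P_p = Σ_{e}
g_d(e)/√2 (c_{p↑}c_{p+e,↓} − c_{p↓}c_{p+e,↑}), g_d = +1 on the two long-direction bonds, −1 on the
two transverse ones) through G_ψ(r) := Σ_a Re⟨ψ, Φ_a† Φ_{a+r} ψ⟩. S⁺: there are U > 0, δ ∈ (0,1/2),
A > 0, C ≥ 0, R, M₁, L₀ such that for ALL even L ≥ L₀ and ALL even widths M₁ ≤ M ≤ L, EVERY
normalised sector ground state ψ obeys the Luther–Emery-shaped lower bound G_ψ(r) ≥ A·L·M²·r̂^{−C/M}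
at every long-cycle displacement with R ≤ r̂ := min(r, L−r): a WIDTH-UNIFORM family of 1D power laws
whose exponent budget C/M shrinks with the width. The diagonal M = L is the summit: r̂^{−C/L} ≥ ½
for r̂ ≤ L/2 once L is large, and Σ_r G_ψ(r) = Re⟨ψ, Δ_d†Δ_d ψ⟩ (steps (2)–(3) of the deciding
theorem `closes`). S⁺ is reached from two cruxes: `WidthUniformThermodynamics` (∃ (U,δ): twist
stiffness per site ρ̃_{L,M} ≥ d₀ and inverse pair compressibility 0 < ẽ″_{L,M} ≤ k₀, uniformly over
the family — both are differences of sector ground-state ENERGIES) and `WidthHaldaneBridge` (∀ (U,δ)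
in the window: such uniform thermodynamics forces the Haldane-form law G_ψ(r) ≥
A·L·M²·r̂^{−Ξ/K̂_{L,M}} with the THERMODYNAMIC Luttinger number K̂_{L,M} := M·√(ρ̃/ẽ″), uniform
amplitude), glued by rpow monotonicity (step (1) of `closes`, C := Ξ√(k₀/d₀)).
Lean: `TubeFamilyLaw`

## Assembly
CRUX-ONLY deciding theorem (rev 5, route-repair 2026-08-16, cone): `closes (h1 : WidthHaldaneBridge)
(h2 : WidthUniformThermodynamics) : HubbardSuperconductivity`, ~140 lines of tactic proof rendered
in the route file, axioms {propext, Classical.choice, Quot.sound}, NO Fock-space relabelling. Both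
cruxes are consumed (the witness point comes from h2, the correlation law from h1 at that point) and
all provable-now glue is DISCHARGED INSIDE the proof, so no support item remains: (1) cruxes ⇒ the
target `TubeFamilyLaw` (rpow monotonicity, C := Ξ√(k₀/d₀), R' := max(R,1)); (2) because the items
quantify over all labellings, the diagonal M = L is read DIRECTLY on the summit's carrier
`FermionTorus 2 L` with e₀ = (x ↦ (x₀, x₁)): the `fromRel` tube graph has the adjacency of
`fermionTorusGraph 2 L` (so the tube Hamiltonian IS `hubbardTorus 2 L 1 U`) and the inlined column
d_{x²−y²} pair operator IS `localPair dWaveFormFactor L (a,b)` (`singletBond`,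
`localPair_dWave_eq_localPairOn_unitSteps` of Literature `LocalPairOn.lean`); (3) the diagonal
column law ⇒ `HasLongRangeOrder` of the pulled-back `pairFieldCorr dWaveFormFactor ψ` along the even
sides (`sum_pairCorr_ge_of_columnLaw`, `hasLongRangeOrder_even_of_le` of Literature
`PairFieldEvenSideLRO.lean`, p112913: Cauchy–Schwarz on the ≤ 2R' short displacements, r̂^{−C/L} ≥
L^{−C/L} ≥ 1/2 eventually, the real liminf kept honest by `pairFieldCorr_succ_le`). Route imports:
`PairFieldEvenSideLRO` + `LocalPairOn` only (module cone 25, no unproved fact); the transport files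
`SiteBijectionSectorTransport` / `SquareTorusDiagonalTube` (p112909 / p113199) remain the provers'
CANONICAL-CARRIER REDUCTION (prove on `Lex (Fin L × Fin M)`, transport to every labelling by
`relabel`/`relabelVec`). Deriving the summit from S⁺ is ROUTINE (the lens requirement) —
kernel-checked. The `Assembly` item `WidthHaldaneBridge → WidthUniformThermodynamics →
HubbardSuperconductivity` is literally the type of `closes`.

Rationale: WHY THIS LINE. The summit asks for 2+1-dimensional U(1) order of itinerant fermions, for which no
rigorous engine exists without reflection positivity; S⁺ trades it for a FAMILY of 1+1-dimensional
statements indexed by the width M, where U(1) order is forbidden and the natural object is the pair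
EXPONENT η(M) — and exponents are what bosonization computes and what constructive 1D
renormalisation proves: Luttinger-liquid behaviour of the 1D Hubbard model [Mastropietro2005] and
the Haldane/Luther–Peschel universality relations tying exponents to the compressibility and the
Drude weight are THEOREMS for non-solvable spinless chains [BenfattoFalcoMastropietro2010,
BenfattoMastropietro2011, Haldane1981]; the weak-coupling N-leg Hubbard ladder flows generically to
a spin-gapped C1S0 phase with approximately d-wave pairing and a single charge mode of stiffness ∝ N
[LinBalentsFisher1997, LinBalentsFisher1998 (integrable SO(8) Gross–Neveu anchor),
LedermannLehurRice2000], numerically a Luther–Emery liquid obeying ν·μ = 1 [NoackWhiteScalapino1996,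
DolfiEtAl2015]; and the wide-tube regime K̂ ∝ M ≫ 1 is the deep Kosterlitz–Thouless phase, the one
regime of abelian models where a power-law LOWER bound is a theorem [FrohlichSpencerKT1981], with
gap generation for many fermion species controlled at large N [KopperMagnenRivasseau1995]. The extra
structure of S⁺ — the width parameter and the exponent identity η = Ξ/K̂ with K̂ read off two
twisted/shifted sector energies (Kohn/Byers–Yang/Scalapino–White–Zhang stiffness [Kohn1964,
ByersYang1961, ScalapinoWhiteZhang1993] and the pair charge gap) — is exactly what makes an attack
possible: 2D long-range order becomes "sup_M M·η(M) < ∞ with uniform amplitude", i.e. extensivity IN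
THE WIDTH of two ground-state energy derivatives plus a width-indexed universality law, and the
induction/doubling in M has the small parameter 1/K̂_M (two Luther–Emery liquids of large stiffness
lock through the seam; single-electron tunnelling is spin-gapped [EmeryKivelsonZachar1997,
ArrigoniFradkinKivelson2004]). Imported areas: bosonization/Luttinger-liquid universality,
constructive fermionic RG in 1+1 D, KT-phase multiscale analysis; dictionary (tube ↦ 1D chain of
columns, Φ_a ↦ local boson, ρ̃·M ↦ 1D stiffness, M/ẽ″ ↦ 1D compressibility, K̂ ↦ Luttinger
parameter, η ↦ Ξ/K̂). No listed route uses aspect-ratio families, tubes, Luttinger exponents or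
Haldane relations; the negatives index (BreathingSelfDual at L = 2, KlsOrderOpenness) is untouched.

RANKED CRUXES. #0 TubeFamilyLaw (target) — S⁺ (the strengthened summit): ∃ U > 0, δ ∈ (0,1/2), C ≥
0, A > 0, R, M₁, L₀ such that for all even L, M with M₁ ≤ M ≤ L, L₀ ≤ L, every normalised (N_{L,M},
S^z=0)-sector ground state ψ of the pure Hubbard tube `hamiltonian G_e 1 U` (any linearly ordered
labelling e : Λ ≃ ℤ/L × ℤ/M) and every long-cycle displacement r with R ≤ r̂ = min(r, L−r):
A·L·M²·r̂^{−C/M} ≤ G_ψ(r) = Σ_a Re⟨ψ, Φ_a†Φ_{a+r} ψ⟩ (Φ_a the column d_{x²−y²} pair field). Diagonal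
M = L ⇒ the summit. (why it might fail: at every (U,δ) some cofinal family of widths may condense
pairs at transverse momentum q_y ≠ 0 (LBF's CEX phase, 4-leg tubes) or lock into commensurate
stripes, so the q_y=0 column field decays fast; width-uniform amplitude across the ladder→2D
crossover (Δ_M ~ e^{−cM} at weak U) is delicate.) [LinBalentsFisher1997, DolfiEtAl2015,
ArrigoniFradkinKivelson2004, Scalapino1995]
#2 WidthHaldaneBridge (crux) — THE HALDANE RELATION CLIMBS THE WIDTH. For every U > 0 and δ ∈ (0,
3/10) (the d_{x²−y²} doping window of the t'=0 band) and all data (d₀ > 0, k₀, M₁, L₀): IF the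
pure-model tubes have width-uniform thermodynamics — twist stiffness per site ρ̃_{L,M}(U,δ) :=
2L[E_{L,M}(θ=π/3) − E_{L,M}(0)]/((π/3)²M) ≥ d₀ and inverse pair compressibility 0 < ẽ″_{L,M} :=
LM[E(N+2)+E(N−2)−2E(N)]/4 ≤ k₀ for all even M₁ ≤ M ≤ L, L ≥ L₀ (E = sector minima `minEnergyOn
(szSector · 0)` of the tube Hamiltonian, the twist θ entering as the seam Peierls phase e^{±iθ} on
the bonds closing the long cycle) — THEN there are Ξ > 0, A > 0, R, M₂, L₁ such that every
normalised sector ground state of every even tube (M₂ ≤ M ≤ L, L ≥ L₁) obeys the Haldane-form law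
G_ψ(r) ≥ A·L·M²·r̂^{−Ξ√(ẽ″_{L,M}/ρ̃_{L,M})/M} = A·L·M²·r̂^{−Ξ/K̂_{L,M}}, K̂ := M√(ρ̃/ẽ″), for R ≤
r̂: the column pair exponent is bounded by the THERMODYNAMIC Luttinger number of the tube, with
width-uniform amplitude (multi-band Luther–Emery universality, η_pair = 1/K_ρ^{tot} with K_ρ^{tot} =
(π/2)√(Dκ) ∝ M). [difficulty: XL] (why it might fail: a stiff, compressible tube need not be C1S0 in
the q_y=0 B1g channel: gapless relative/spin modes (C1Sn) or a non-d_{x²−y²} condensate at some (U,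
δ<0.3) with uniform thermodynamics would give exponent ≫ Ξ/K̂ cofinally in M; amplitude uniformity
is non-universal.) [BenfattoFalcoMastropietro2010, BenfattoMastropietro2011, Haldane1981,
Mastropietro2005, LinBalentsFisher1997, DolfiEtAl2015, FrohlichSpencerKT1981,
KopperMagnenRivasseau1995]
#3 WidthUniformThermodynamics (crux) — WIDTH-UNIFORM STIFFNESS AND COMPRESSIBILITY OF THE PURE
MODEL. There are U > 0, δ ∈ (0, 3/10), d₀ > 0, k₀, M₁, L₀ such that for all even L ≥ L₀ and all even
widths M₁ ≤ M ≤ L the pure Hubbard tube Λ_{L,M} at filling N_{L,M} = 2⌊(1−δ)LM/2⌋, S^z = 0, has (i)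
twist stiffness per site ρ̃_{L,M} ≥ d₀ (the Byers–Yang/Kohn/Scalapino–White–Zhang superfluid-weight
criterion read on the sector-minimum envelope at the fixed sub-half-flux-quantum twist θ₀ = π/3
through the long cycle, so that metals, whose envelope flattens after θ ~ 2π/M, and insulators FAIL,
uniformly over aspect ratios — 1D stiffness ∝ M) and (ii) strictly positive, bounded inverse pair
compressibility 0 < ẽ″_{L,M} ≤ k₀ (no charge gap, no phase separation, smooth even-N staircase).
Both are differences of sector ground-state energies only (blind to degeneracy and towers).
[difficulty: XL] (why it might fail: at every (U, δ<0.3) some widths may be insulating/striped (ẽ″ →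
∞) or envelope-soft (relative charge modes unlocked, ρ̃ ~ 1/M²); at weak U the needed L₀ ~ sup_M ξ_M
is astronomically large and shell effects make ρ̃ < 0 below it — fine for truth, fatal if sup_M ξ_M
= ∞.) [ScalapinoWhiteZhang1993, Kohn1964, ByersYang1961, LinBalentsFisher1997,
NoackWhiteScalapino1996, QinEtAl2020, DengEtAl2015]
(rev 4: the former #9 support items SquareLaw, FamilyLawOfCruxes, SquareTransfer,
DiagonalBookkeeping are DROPPED — their content is proved inside the crux-only `closes` / Literature
PairFieldEvenSideLRO; SquareLaw (the diagonal shadow of S⁺) is the inlined intermediate of `closes`.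
#1 Assembly (WidthHaldaneBridge → WidthUniformThermodynamics → HubbardSuperconductivity) stays as
the recorded assembly statement: it is literally the type of `closes`. rev 5 (route-repair, cone):
#0/#2/#3 re-typed over ALL linearly ordered labellings e : Λ ≃ ℤ/L × ℤ/M (same statements by
relabelling invariance); `closes` reads the diagonal on FermionTorus 2 L directly, dropping the
relabelling imports whose cone held the unused unproved fact bgm_two_point_limit.)

TWO-LAYER PLAN. Foreseen first split of WidthHaldaneBridge (only after WidthUniformThermodynamics
moves or a census asks): Bridge ⇐ NarrowBase → SeamDoubling → Bridge, where NarrowBase is the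
per-width Luther–Emery/Haldane law for the finitely many widths M₂ ≤ M < 2M₂ (1D constructive RG
targets: [Mastropietro2005]-type Ward identities for the charge mode, gap generation for the
relative/spin modes via the integrable SO(8)/large-N Gross–Neveu anchors [LinBalentsFisher1998,
KopperMagnenRivasseau1995]) and SeamDoubling is the locking lemma "two width-M tubes of Luttinger
number K̂_M glued along the two seams form a width-2M tube of Luttinger number ≥ 2K̂_M(1 − c/K̂_M)
and amplitude ≥ A(1 − c/K̂_M)" (sine-Gordon for the relative phase with stiffness ∝ M, semiclassical
as M → ∞; pair tunnelling relevant, single-electron tunnelling spin-gapped [EmeryKivelsonZachar1997,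
ArrigoniFradkinKivelson2004]) plus an unequal-width variant to reach non-dyadic widths; losses
summable along the binary merge tree give width-uniform constants. Foreseen split of
WidthUniformThermodynamics: {StiffnessFloor (ρ̃ ≥ d₀: envelope superfluid weight, shared in spirit
with FluxSpectroscopy.FluxWindow on square tori), CompressibilityCeiling (0 < ẽ″ ≤ k₀)}.

KILL CRITERIA. Refutation of WidthUniformThermodynamics as typed (e.g. a proof that for every (U,
δ<3/10) the twist stiffness per site of the pure tubes is not bounded below uniformly in the width,
or that ẽ″ is unbounded/negative cofinally) closes the route (`--reason
refuted:WidthUniformThermodynamics`) unless the refutation is a pure normalisation artefact of θ₀ =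
π/3 (then restate with ∃θ₀ ∈ (0,π/2)). Refutation of WidthHaldaneBridge by a stiff-compressible
point with a non-B1g or q_y ≠ 0 condensate forces ONE pivot: restate the bridge with an explicit
B1g-selection hypothesis (column pair dominance at the smallest width) — if that also dies, close. A
proof elsewhere of HasDWavePairFieldLROAt at some (U,δ) moots the route (summit closed); a proof of
FluxSpectroscopy.FluxBridge would make WidthHaldaneBridge's diagonal instance redundant but not the
route.

NOT DECOMPOSED YET. The per-width Luther–Emery theorems, the seam/doubling lemma, the treatment of
widths below M₂ (CEX/commensurate exceptions), the B1g selection inside the bridge, and the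
quantitative constants (Ξ in our θ₀ = π/3, ΔN = 2 normalisation; the expected universal value
corresponds to η_pair = 1/K_ρ^{tot}) are layer-2; so is the choice of the witness point (proposal:
weak-to-moderate U ∈ (0,4], δ ∈ [0.15, 0.3), away from the catalogued stripe point (8, 1/8)).

CHEAPEST FALSIFIER. DMRG on the pure Hubbard tubes of widths M = 2, 4, 6 (periodic transverse b.c.,
lengths L ≤ 128) at the proposal point: measure the column d-wave pair correlator G(r), the twist
envelope E(π/3) − E(0) and Δ₂E; the line dies if (a) μ_M·K̂_{L,M} (fitted exponent × thermodynamic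
Luttinger number) is not O(1)-stable across widths, or (b) ρ̃ collapses like 1/M², or (c) the 4- and
6-leg tubes condense at q_y ≠ 0 throughout δ < 0.3. Literature lookup: DolfiEtAl2015 (2-leg, U = 8,
n = 0.875–0.97) confirms the Luther–Emery identity ν·μ = 1 with K_ρ from independent
(Friedel/compressibility) data — the M = 2 instance of the bridge's mechanism; LinBalentsFisher1997
§V reports a CEX (q_y = π) d-wave phase on 4-leg tubes in PART of the weak-coupling phase diagram —
the reason the bridge exempts widths below M₂ and the window stops at δ = 3/10. No kit job run (ED
at L ≤ 4 is uninformative for exponents).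

NUMBERS. Luther–Emery 2-leg Hubbard ladder: N(r) ~ r^{−K_ρ}, D(r) ~ r^{−1/K_ρ}, K_ρ > 1 at low
doping, U = 8 [DolfiEtAl2015 §2, Tab. I]; weak-coupling N-leg ladders: generic pairing instability
with approximate d-wave gap function, T_c(N) ~ Δ_N ~ e^{−N} in the scaled weak-coupling limit, CEX
phase for N = 4 periodic [LinBalentsFisher1997 abstract, §I, §V]; Haldane relations κ = K/(πv), D =
vK/π, x₋ = 1/x₊ proved for non-solvable spinless chains [BenfattoFalcoMastropietro2010 Theorem;
BenfattoMastropietro2011]; weak-coupling t'=0 channel: d_{x²−y²} below the crossing δ* ≈ 0.35–0.45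
[DengEtAl2015, SimkovicEtAl2016, RaghuKivelsonScalapino2010]; stripe no-go point (8, 1/8)
[QinEtAl2020]. Probe conventions: θ₀ = π/3 < π/2 (below the hc/2e cusp), ΔN = 2.

DEFINITION REQUESTS. None needed to open (all decls inline `hamiltonian (SimpleGraph.fromRel …) 1 U`
on a labelled carrier Λ ≃ ℤ/L × ℤ/M, the seam twist, `Matrix.minEnergyOn`, `szSector`,
`IsGroundStateInSector`, `annihilation/creation/orb`, `expect`). To shorten the items later:
`hubbardTube L M U θ` (tube Hamiltonian with seam twist), `tubeColumnPair L M a` (column d-wave pair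
field), `tubeLuttingerNumber L M U δ` — to be filed under
Summits/HubbardSuperconductivity/HubbardSuperconductivity/Theorems once the route is served.

SUPPORT. None as items (rev 4–5): every provable-now statement is proved inside `closes` or in
Literature; future helpers ride as `--supports` files.

Novelty: Searches (2026-08-16): lever table over all 43 open routes + 12 closed theses of the sub (none uses
width/aspect-ratio families, tubes, bosonization, Luttinger/Haldane relations, dimensional
crossover); `lit galaxy search "Luther-Emery" --star all` (24 rows: textbooks
Giamarchi/Gogolin–Nersesyan–Tsvelik/Voit, no Hubbard-width theorem); `lit galaxy search "N-chain
Hubbard model in weak coupling" | "Pair correlations in doped Hubbard ladders" | "Universality of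
one-dimensional Fermi systems" | "striped Hubbard model" | "large N Gross-Neveu" --star pdf` (0–4
rows each; BFM CMP found); `lit search --source arxiv` for Lin–Balents–Fisher 1997/1998, Dolfi et al
2015, Benfatto–Falco–Mastropietro 2009, Benfatto–Mastropietro 2011, Mastropietro 2005,
Arrigoni–Fradkin–Kivelson 2004, Emery–Kivelson–Zachar 1997, Noack–White–Scalapino 1996, Ledermann–Le
Hur–Rice 2000 (1 hit each, read with `lit read --grep`); crossref for Kopper–Magnen–Rivasseau 1995;
`lit search --source arxiv "dimensional crossover coupled Luttinger liquids superconductivity"` (0).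
Local `lit search`/OpenAlex were unavailable (daemon reset / 429) — logged in NOTES.md.
Nearest prior art found: LinBalentsFisher1997 (arXiv:cond-mat/9703055, §VI: weak-coupling
dimensional crossover N → ∞ of Hubbard ladders, heuristic RG; warns T_c(N) ~ e^{−N} in the scaled
limit), ArrigoniFradkinKivelson2004 (arXiv:cond-mat/0309572: 2D d-wave SC from an ARRAY of weakly
coupled spin-gapped 2-leg ladders — an inhomogeneous model, perturbative i  [refs: cond-mat/9703055, cond-mat/0309572, 1509.04709, 0909.2707, LinBalentsFisher1997, ArrigoniFradkinKivelson2004, DolfiEtAl2015, BenfattoFalcoMastropietro2010]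

Barriers (technique_class: dimensional-crossover, luttinger-universality): - technique_class: dimensional-crossover, luttinger-universality
- Literature.Barriers.HubbardSuperconductivity.HohenbergMerminWagnerPairing: evaded by design —
every member of the family with M < L is quasi-1D where U(1) order is forbidden and the statement IS
a power law; T = 0 throughout; on the diagonal the bound r̂^{−C/L} is LRO-compatible because the
exponent vanishes with the width, not because a fixed-width system orders.
- Literature.Barriers.HubbardSuperconductivity.PositiveTemperatureNoPairLRO: not engaged (ground
states only; no Gibbs state is claimed ordered).
- Literature.Barriers.HubbardSuperconductivity.LROForcesLowLyingStates: harmless — both cruxes read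
sector-minimum ENERGIES (blind to towers/degeneracy) and the law is asserted for EVERY sector ground
state; the Anderson tower is the k = 0 rotor whose finite-size charging energy is exactly ẽ″/(LM).
- Literature.Barriers.HubbardSuperconductivity.GeneralizedHartreeFockNoPairing: not in the technique
class — no quasi-free variational state is used; Luttinger/Luther–Emery states are non-Gaussian.
- Literature.Barriers.HubbardSuperconductivity.WeakCouplingCeiling: it bites the CONSTANTS, not the
statements: at weak U the thresholds L₀ ~ sup_M ξ_M ~ e^{c/U²} are beyond any convergent expansion's
reach; the bet is that the width-indexed 1D RG (where the Cooper logarithm is cut by the transverse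
level spacing ~ 1/M and gap generation is a 1D strong-coupling flow with integrable/large-N anchors)
replaces the 2D expa

History (route lifecycle, newest last):
- 2026-08-16T17:48:27Z · rev 4: dropped SquareLaw, FamilyLawOfCruxes, SquareTransfer, DiagonalBookkeeping — route-repair (glue) cleanup: drop the four support items whose content is now PROVED inside the crux-only deciding theorem closes (SquareLaw = inlined intermedi (planner-rbadge-HubbardSuperconductivity-WidthH-5a408e14-0)
- 2026-08-16T18:17:41Z · rev 5: restated TubeFamilyLaw (stmt-HubbardSuperconductivity-15595), WidthHaldaneBridge (stmt-HubbardSuperconductivity-15596), WidthUniformThermodynamics (stmt-HubbardSuperconductivity-15597) — route-repair (cone; unit rrepair-HubbardSuperconductivity-Width-5a408e14): the dispatcher's module-level cone listed Literatur (planner-rrepair-HubbardSuperconductivity-Width-5a408e14-0)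
- 2026-08-24T05:54:01Z · DORMANT — reconciler: no traction for 6.6 d (last activity item-evidence-added at 2026-08-17T15:42:32Z); parked, not closed — `ledger route dormant route-HubbardSupercond (operator:999:3496390)
- 2026-08-29T10:33:11Z · REACTIVATED — reconciler: reactivated — activity item-proof-filed at 2026-08-29T09:35:51Z after parking at 2026-08-24T05:54:01Z (operator:999:2634165)
- 2026-09-03T16:18:32Z · DORMANT — reconciler: no traction for 5 d (last activity statement-checked at 2026-08-29T15:23:39Z); parked, not closed — `ledger route dormant route-HubbardSuperconducti (operator:999:1319124)

sub-problem: HubbardSuperconductivity · status: dormant · opened planner-plan-lens-HubbardSuperconductivity-strengthen-0 2026-08-16T15:14:09Z · rev 6 · ledger route-HubbardSuperconductivity-WidthHaldane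
GENERATED by the gate from the ledger (D-0016/17). Provers cite these decls: `theorem foo : Summit.HubbardSuperconductivity.HubbardSuperconductivity.Theses.WidthHaldane.<Decl> := …` in Summits/HubbardSuperconductivity/HubbardSuperconductivity/Theorems/<Name>.lean.
-/

namespace Summit.HubbardSuperconductivity.HubbardSuperconductivity.Theses.WidthHaldane

open scoped BigOperators Topology Manifold Classical MeasureTheory ProbabilityTheory Matrix InnerProductSpace ComplexConjugate ContinuousMap
open Filter Set Function TopologicalSpace MeasureTheory

attribute [summit_statement] _root_.HubbardSuperconductivity

open Literature.Hubbard

-- earlier TubeFamilyLaw (stmt-HubbardSuperconductivity-15595, replaced 2026-08-16T18:17:41Z -> stmt-HubbardSuperconductivity-16310): retired by None — open Matrix Literature.MathematicalPhysics.QuantumLattice in let H0 : ∀ (L M : ℕ) [NeZero L] [NeZero M], ℝ → Matrix (Finset (Orb (Lex (Fin L × Fin M)))) (Finset (Orb (Lex (Fin L × Fin M)))) ℂ := fun L M _ _ U => hamiltonian (SimpleGraph.fromRel fun p 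
/-- item stmt-HubbardSuperconductivity-16310 · target · rank 0 · open · by planner
why it might fail: at every (U,δ) some cofinal family of widths may condense pairs at transverse momentum q_y ≠ 0 (LBF's CEX phase, 4-leg tubes) or lock into commensurate stripes, so the q_y=0 column field decays fast; width-uniform amplitude across the ladder→2D crossover (Δ_M ~ e^{−cM} at weak U) is delicate.
sources: LinBalentsFisher1997, DolfiEtAl2015, ArrigoniFradkinKivelson2004, Scalapino1995
[target] S⁺ (the strengthened summit), CARRIER-FREE TYPING (rev 5, route-repair/cone): ∃ U > 0, δ ∈
(0,1/2), C ≥ 0, A > 0, R, M₁, L₀ such that for all even L, M with M₁ ≤ M ≤ L, L₀ ≤ L, for EVERY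
finite linearly ordered labelling e : Λ ≃ ℤ/L × ℤ/M of the sites (the Jordan–Wigner order is
immaterial: all labellings of one tube are unitarily equivalent by the signed-permutation
relabelling — Literature SiteBijectionSectorTransport / SquareTorusDiagonalTube give the
canonical-carrier reduction for provers), every normalised (N_{L,M} = 2⌊(1−δ)LM/2⌋, S^z = 0)-sector
ground state ψ of the pure Hubbard tube `hamiltonian G_e 1 U` (G_e = nearest-neighbour graph of ℤ/L
× ℤ/M pulled back along e, steps (a,b) ↦ (a+1,b), (a,b+1)) and every long-cycle displacement r ∈ ℤ/L
with R ≤ r̂ = min(r, L−r): A·L·M²·r̂^{−C/M} ≤ G_ψ(r) = Σ_a Re⟨ψ, Φ_a†Φ_{a+r} ψ⟩, Φ_a = Σ_b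
P_{e⁻¹(a,b)} the column d_{x²−y²} pair field (P_x = Σ_j w_j/√2 (c_{x↑}c_{n_j↓} − c_{x↓}c_{n_j↑}),
neighbours n = e⁻¹(a±1,b), e⁻¹(a,b±1), weights w = (1,1,−1,−1)). At M = L, Λ = FermionTorus 2 L, e₀
= (x ↦ (x₀,x₁)) this is LITERALLY the summit's torus: same adjacency as `fermionTorusGraph 2 L` (so
the Hamiltonian is `hubbardTorus 2 L 1 U`) -/
@[route_item "route-HubbardSuperconductivity-WidthHaldane"]
def TubeFamilyLaw : Prop :=
  open Matrix Literature.MathematicalPhysics.QuantumLattice in let H0 : ∀ (L M : ℕ) (Λ : Type) [LinearOrder Λ] [Fintype Λ], (Λ ≃ ZMod L × ZMod M) → ℝ → Matrix (Finset (Orb Λ)) (Finset (Orb Λ)) ℂ := fun _ _ Λ _ _ e U => hamiltonian (SimpleGraph.fromRel fun x y : Λ => y = e.symm ((e x).1 + 1, (e x).2) ∨ y = e.symm ((e x).1, (e x).2 + 1)) 1 U; let Np : ℕ → ℕ → ℝ → ℕ := fun L M δ => 2 * ⌊(1 - δ) * ((L : ℝ) * (M : ℝ)) / 2⌋₊; let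 P : ∀ (L M : ℕ) (Λ : Type) [LinearOrder Λ] [Fintype Λ], (Λ ≃ ZMod L × ZMod M) → Λ → Matrix (Finset (Orb Λ)) (Finset (Orb Λ)) ℂ := fun _ _ Λ _ _ e x => ∑ j : Fin 4, (((![1, 1, -1, -1] : Fin 4 → ℝ) j / Real.sqrt 2 : ℝ) : ℂ) • (annihilation (orb x 0) * annihilation (orb ((![e.symm ((e x).1 + 1, (e x).2), e.symm ((e x).1 - 1, (e x).2), e.symm ((e x).1, (e x).2 + 1), e.symm ((e x).1, (e x).2 - 1)] : Fin 4 → Λ) j) 1) - annihilation (orb x 1) * annihilation (orb ((![e.symm ((e x).1 + 1, (e x).2), e.symm ((e x).1 - 1, (e x).2), e.symm ((e x).1, (e x).2 + 1), e.symm ((e x).1, (e x).2 - 1)] : Fin 4 → Λ) j) 0)); let G : ∀ (L M : ℕ) [NeZero L] [NeZero M] (Λ : Type) [LinearOrder Λ] [Fintype Λ], (Λ ≃ ZMod L × ZMod M) → Fock (Orb Λ) → ZMod L → ℝ := fun L M _ _ Λ _ _ e ψ r => ∑ a : ZMod L, (expect ((∑ b : ZMod M, P L M Λ e (e.symm (a,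 b)))ᴴ * (∑ b : ZMod M, P L M Λ e (e.symm (a + r, b)))) ψ).re; ∃ U : ℝ, 0 < U ∧ ∃ δ ∈ Set.Ioo (0 : ℝ) (1 / 2), ∃ C : ℝ, 0 ≤ C ∧ ∃ A : ℝ, 0 < A ∧ ∃ R M₁ L₀ : ℕ, ∀ (L M : ℕ) [NeZero L] [NeZero M], Even L → Even M → M₁ ≤ M → M ≤ L → L₀ ≤ L → ∀ (Λ : Type) [LinearOrder Λ] [Fintype Λ] (e : Λ ≃ ZMod L × ZMod M), ∀ ψ : Fock (Orb Λ), star ψ ⬝ᵥ ψ = 1 → IsGroundStateInSector (H0 L M Λ e U) (Np L M δ) 0 ψ → ∀ r : ZMod L, R ≤ r.val → r.val + R ≤ L → A * (L : ℝ) * (M : ℝ) ^ 2 * ((min r.val (L - r.val) : ℕ) : ℝ) ^ (-(C / (M : ℝ))) ≤ G L M Λ e ψ r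

-- earlier WidthHaldaneBridge (stmt-HubbardSuperconductivity-15596, replaced 2026-08-16T18:17:41Z -> stmt-HubbardSuperconductivity-16311): retired by None — open Matrix Literature.MathematicalPhysics.QuantumLattice in let H0 : ∀ (L M : ℕ) [NeZero L] [NeZero M], ℝ → Matrix (Finset (Orb (Lex (Fin L × Fin M)))) (Finset (Orb (Lex (Fin L × Fin M)))) ℂ := fun L M _ _ U => hamiltonian (SimpleGraph.fromRel f
/-- item stmt-HubbardSuperconductivity-16311 · crux · rank 2 · open · by planner
why it might fail: a stiff, compressible tube need not be C1S0 in the q_y=0 B1g channel: gapless relative/spin modes (C1Sn) or a non-d_{x²−y²} condensate at some (U, δ<0.3) with uniform thermodynamics would give exponent ≫ Ξ/K̂ cofinally in M; amplitude uniformity is non-universal.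
sources: BenfattoFalcoMastropietro2010, BenfattoMastropietro2011, Haldane1981, Mastropietro2005, LinBalentsFisher1997, DolfiEtAl2015
[crux] THE HALDANE RELATION CLIMBS THE WIDTH (carrier-free typing, rev 5: hypothesis and conclusion
quantify over all linearly ordered labellings e : Λ ≃ ℤ/L × ℤ/M of the tube; equivalent to the
fixed-carrier rev-1 statement by relabelling invariance of sector energies, sector ground states and
expectations). For every U > 0 and δ ∈ (0, 3/10) (the d_{x²−y²} doping window of the t'=0 band) and
all data (d₀ > 0, k₀, M₁, L₀): IF the pure-model tubes have width-uniform thermodynamics — twist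
stiffness per site ρ̃_{L,M}(U,δ) := 2L[E_{L,M}(θ=π/3) − E_{L,M}(0)]/((π/3)²M) ≥ d₀ and inverse pair
compressibility 0 < ẽ″_{L,M} := LM[E(N+2)+E(N−2)−2E(N)]/4 ≤ k₀ for all even M₁ ≤ M ≤ L, L ≥ L₀ and
all labellings (E = sector minima `minEnergyOn (szSector · 0)` of the tube Hamiltonian, the twist θ
entering as the seam Peierls phase e^{±iθ} on the M bonds between the columns of long coordinate −1
and 0) — THEN there are Ξ > 0, A > 0, R, M₂, L₁ such that every normalised sector ground state of
every even tube (M₂ ≤ M ≤ L, L ≥ L₁, any labelling) obeys the Haldane-form law G_ψ(r) ≥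
A·L·M²·r̂^{−Ξ√(ẽ″_{L,M}/ρ̃_{L,M})/M} = A·L·M²·r̂^{−Ξ/K̂_{L,M}}, K̂ := M√(ρ̃/ẽ″), for R ≤ r̂: the
column pair exponent is b -/
@[route_item "route-HubbardSuperconductivity-WidthHaldane"]
def WidthHaldaneBridge : Prop :=
  open Matrix Literature.MathematicalPhysics.QuantumLattice in let H0 : ∀ (L M : ℕ) (Λ : Type) [LinearOrder Λ] [Fintype Λ], (Λ ≃ ZMod L × ZMod M) → ℝ → Matrix (Finset (Orb Λ)) (Finset (Orb Λ)) ℂ := fun _ _ Λ _ _ e U => hamiltonian (SimpleGraph.fromRel fun x y : Λ => y = e.symm ((e x).1 + 1, (e x).2) ∨ y = e.symm ((e x).1, (e x).2 + 1)) 1 U; let Tw : ∀ (L M : ℕ) [NeZero L] [NeZero M] (Λ : Type) [LinearOrder Λ] [Fintype Λ], (Λ ≃ ZMod L × ZMod M) → ℝ → Matrix (Finset (Orb Λ)) (Finset (Orb Λ)) ℂ := fun _ M _ _ _ _ _ e θ => ∑ b : ZMod M, ∑ σ : Fin 2, ((1 - Complex.exp (Complex.I * θ)) • (creation (orb (e.symm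 (0, b)) σ) * annihilation (orb (e.symm (-1, b)) σ)) + (1 - Complex.exp (-(Complex.I * θ))) • (creation (orb (e.symm (-1, b)) σ) * annihilation (orb (e.symm (0, b)) σ))); let E : ∀ (L M : ℕ) [NeZero L] [NeZero M] (Λ : Type) [LinearOrder Λ] [Fintype Λ], (Λ ≃ ZMod L × ZMod M) → ℝ → ℝ → ℕ → ℝ := fun L M _ _ Λ _ _ e U θ N => (H0 L M Λ e U + Tw L M Λ e θ).minEnergyOn (szSector N 0); let Np : ℕ → ℕ → ℝ → ℕ := fun L M δ => 2 * ⌊(1 - δ) * ((L : ℝ) * (M : ℝ)) / 2⌋₊; let stiff : ∀ (L M : ℕ) [NeZero L] [NeZero M] (Λ : Type) [LinearOrder Λ] [Fintype Λ], (Λ ≃ ZMod L × ZMod M) → ℝ → ℝ → ℝ := fun L M _ _ Λ _ _ e U δ => 2 * (L : ℝ) * (E L M Λ e U (Real.pi / 3) (Np L M δ) - E L M Λ e U 0 (Np L M δ)) / ((Real.pi / 3) ^ 2 * (M : ℝ)); let icomp : ∀ (L M : ℕ) [NeZero L] [NeZero M] (Λ : Type) [LinearOrder Λ] [Fintype Λ],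 (Λ ≃ ZMod L × ZMod M) → ℝ → ℝ → ℝ := fun L M _ _ Λ _ _ e U δ => (L : ℝ) * (M : ℝ) * (E L M Λ e U 0 (Np L M δ + 2) + E L M Λ e U 0 (Np L M δ - 2) - 2 * E L M Λ e U 0 (Np L M δ)) / 4; let P : ∀ (L M : ℕ) (Λ : Type) [LinearOrder Λ] [Fintype Λ], (Λ ≃ ZMod L × ZMod M) → Λ → Matrix (Finset (Orb Λ)) (Finset (Orb Λ)) ℂ := fun _ _ Λ _ _ e x => ∑ j : Fin 4, (((![1, 1, -1, -1] : Fin 4 → ℝ) j / Real.sqrt 2 : ℝ) : ℂ) • (annihilation (orb x 0) * annihilation (orb ((![e.symm ((e x).1 + 1, (e x).2), e.symm ((e x).1 - 1, (e x).2), e.symm ((e x).1, (e x).2 + 1), e.symm ((e x).1, (e x).2 - 1)] : Fin 4 → Λ) j) 1) - annihilation (orb x 1) * annihilation (orb ((![e.symm ((e x).1 + 1, (e x).2), e.symm ((e x).1 - 1, (e x).2), e.symm ((e x).1, (e x).2 + 1), e.symm ((e x).1, (e x).2 - 1)] : Fin 4 → Λ) j) 0)); let G : ∀ (L M : ℕ)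 [NeZero L] [NeZero M] (Λ : Type) [LinearOrder Λ] [Fintype Λ], (Λ ≃ ZMod L × ZMod M) → Fock (Orb Λ) → ZMod L → ℝ := fun L M _ _ Λ _ _ e ψ r => ∑ a : ZMod L, (expect ((∑ b : ZMod M, P L M Λ e (e.symm (a, b)))ᴴ * (∑ b : ZMod M, P L M Λ e (e.symm (a + r, b)))) ψ).re; ∀ U : ℝ, 0 < U → ∀ δ ∈ Set.Ioo (0 : ℝ) (3 / 10), ∀ (d₀ k₀ : ℝ) (M₁ L₀ : ℕ), 0 < d₀ → (∀ (L M : ℕ) [NeZero L] [NeZero M], Even L → Even M → M₁ ≤ M → M ≤ L → L₀ ≤ L → ∀ (Λ : Type) [LinearOrder Λ] [Fintype Λ] (e : Λ ≃ ZMod L × ZMod M), d₀ ≤ stiff L M Λ e U δ ∧ 0 < icomp L M Λ e U δ ∧ icomp L M Λ e U δ ≤ k₀) → ∃ Ξ : ℝ, 0 < Ξ ∧ ∃ A : ℝ, 0 < A ∧ ∃ R M₂ L₁ : ℕ, ∀ (L M : ℕ) [NeZero L] [NeZero M], Even L → Even M → M₂ ≤ M → M ≤ L → L₁ ≤ L →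 ∀ (Λ : Type) [LinearOrder Λ] [Fintype Λ] (e : Λ ≃ ZMod L × ZMod M), ∀ ψ : Fock (Orb Λ), star ψ ⬝ᵥ ψ = 1 → IsGroundStateInSector (H0 L M Λ e U) (Np L M δ) 0 ψ → ∀ r : ZMod L, R ≤ r.val → r.val + R ≤ L → A * (L : ℝ) * (M : ℝ) ^ 2 * ((min r.val (L - r.val) : ℕ) : ℝ) ^ (-(Ξ * Real.sqrt (icomp L M Λ e U δ / stiff L M Λ e U δ) / (M : ℝ))) ≤ G L M Λ e ψ r

-- earlier WidthUniformThermodynamics (stmt-HubbardSuperconductivity-15597, replaced 2026-08-16T18:17:41Z -> stmt-HubbardSuperconductivity-16312): retired by None — open Matrix Literature.MathematicalPhysics.QuantumLattice in let H0 : ∀ (L M : ℕ) [NeZero L] [NeZero M], ℝ → Matrix (Finset (Orb (Lex (Fin L × Fin M)))) (Finset (Orb (Lex (Fin L × Fin M)))) ℂ := fun L M _ _ U => hamiltonian (SimpleGraph.f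
/-- item stmt-HubbardSuperconductivity-16312 · crux · rank 3 · open · by planner
why it might fail: at every (U, δ<0.3) some widths may be insulating/striped (ẽ″ → ∞) or envelope-soft (relative charge modes unlocked, ρ̃ ~ 1/M²); at weak U the needed L₀ ~ sup_M ξ_M is astronomically large and shell effects make ρ̃ < 0 below it — fine for truth, fatal if sup_M ξ_M = ∞.
sources: ScalapinoWhiteZhang1993, Kohn1964, ByersYang1961, LinBalentsFisher1997, NoackWhiteScalapino1996, QinEtAl2020
[crux] WIDTH-UNIFORM STIFFNESS AND COMPRESSIBILITY OF THE PURE MODEL (carrier-free typing, rev 5: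
the two energy functionals are invariant under relabelling of the sites, so the added '∀ labellings
e : Λ ≃ ℤ/L × ℤ/M' is free; provers may fix the canonical carrier and transport with
SiteBijectionSectorTransport). There are U > 0, δ ∈ (0, 3/10), d₀ > 0, k₀, M₁, L₀ such that for all
even L ≥ L₀, all even widths M₁ ≤ M ≤ L and every linearly ordered labelling of the sites, the pure
Hubbard tube Λ_{L,M} at filling N_{L,M} = 2⌊(1−δ)LM/2⌋, S^z = 0, has (i) twist stiffness per site
ρ̃_{L,M} ≥ d₀ (the Byers–Yang/Kohn/Scalapino–White–Zhang superfluid-weight criterion read on the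
sector-minimum envelope at the fixed sub-half-flux-quantum twist θ₀ = π/3 through the long cycle, so
that metals, whose envelope flattens after θ ~ 2π/M, and insulators FAIL, uniformly over aspect
ratios — 1D stiffness ∝ M) and (ii) strictly positive, bounded inverse pair compressibility 0 <
ẽ″_{L,M} ≤ k₀ (no charge gap, no phase separation, smooth even-N staircase). Both are differences of
sector ground-state energies only (blind to degeneracy and towers). [difficulty: XL] -/
@[route_item "route-HubbardSuperconductivity-WidthHaldane"]
def WidthUniformThermodynamics : Prop :=
  open Matrix Literature.MathematicalPhysics.QuantumLattice in let H0 : ∀ (L M : ℕ) (Λ : Type) [LinearOrder Λ] [Fintype Λ], (Λ ≃ ZMod L × ZMod M) → ℝ → Matrix (Finset (Orb Λ)) (Finset (Orb Λ)) ℂ := fun _ _ Λ _ _ e U => hamiltonian (SimpleGraph.fromRel fun x y : Λ => y = e.symm ((e x).1 + 1, (e x).2) ∨ y = e.symm ((e x).1, (e x).2 + 1)) 1 U; let Tw : ∀ (L M : ℕ) [NeZero L] [NeZero M] (Λ : Type) [LinearOrder Λ] [Fintype Λ], (Λ ≃ ZMod L × ZMod M) → ℝ → Matrix (Finset (Orb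 Λ)) (Finset (Orb Λ)) ℂ := fun _ M _ _ _ _ _ e θ => ∑ b : ZMod M, ∑ σ : Fin 2, ((1 - Complex.exp (Complex.I * θ)) • (creation (orb (e.symm (0, b)) σ) * annihilation (orb (e.symm (-1, b)) σ)) + (1 - Complex.exp (-(Complex.I * θ))) • (creation (orb (e.symm (-1, b)) σ) * annihilation (orb (e.symm (0, b)) σ))); let E : ∀ (L M : ℕ) [NeZero L] [NeZero M] (Λ : Type) [LinearOrder Λ] [Fintype Λ], (Λ ≃ ZMod L × ZMod M) → ℝ → ℝ → ℕ → ℝ := fun L M _ _ Λ _ _ e U θ N => (H0 L M Λ e U + Tw L M Λ e θ).minEnergyOn (szSector N 0); let Np : ℕ → ℕ → ℝ → ℕ := fun L M δ => 2 * ⌊(1 - δ) * ((L : ℝ) * (M : ℝ)) / 2⌋₊; let stiff : ∀ (L M : ℕ) [NeZero L] [NeZero M] (Λ : Type) [LinearOrder Λ] [Fintype Λ], (Λ ≃ ZMod L × ZMod M) → ℝ → ℝ → ℝ := fun L M _ _ Λ _ _ e U δ => 2 * (L : ℝ) * (E L M Λ e U (Real.pi / 3) (Np L M δ) - E L M Λ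 e U 0 (Np L M δ)) / ((Real.pi / 3) ^ 2 * (M : ℝ)); let icomp : ∀ (L M : ℕ) [NeZero L] [NeZero M] (Λ : Type) [LinearOrder Λ] [Fintype Λ], (Λ ≃ ZMod L × ZMod M) → ℝ → ℝ → ℝ := fun L M _ _ Λ _ _ e U δ => (L : ℝ) * (M : ℝ) * (E L M Λ e U 0 (Np L M δ + 2) + E L M Λ e U 0 (Np L M δ - 2) - 2 * E L M Λ e U 0 (Np L M δ)) / 4; ∃ U : ℝ, 0 < U ∧ ∃ δ ∈ Set.Ioo (0 : ℝ) (3 / 10), ∃ d₀ : ℝ, 0 < d₀ ∧ ∃ k₀ : ℝ, ∃ M₁ L₀ : ℕ, ∀ (L M : ℕ) [NeZero L] [NeZero M], Even L → Even M → M₁ ≤ M → M ≤ L → L₀ ≤ L → ∀ (Λ : Type) [LinearOrder Λ] [Fintype Λ] (e : Λ ≃ ZMod L × ZMod M), d₀ ≤ stiff L M Λ e U δ ∧ 0 < icomp L M Λ e U δ ∧ icomp L M Λ e U δ ≤ k₀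

/-- item stmt-HubbardSuperconductivity-15602 · assembly · rank 1 · closed · proved by Summit.HubbardSuperconductivity.HubbardSuperconductivity.Theorems.WidthHaldane.widthHaldane_assembly_proof (prover) · by planner
sources: Scalapino1995
[assembly] WidthHaldaneBridge → WidthUniformThermodynamics → HubbardSuperconductivity (via
FamilyLawOfCruxes, SquareTransfer, DiagonalBookkeeping; `assembly_of_supports` in Sketch.lean). -/
@[route_item "route-HubbardSuperconductivity-WidthHaldane"]
def Assembly : Prop :=
  WidthHaldaneBridge → WidthUniformThermodynamics → HubbardSuperconductivity

-- `Assembly` holds: proved by `Summit.HubbardSuperconductivity.HubbardSuperconductivity.Theorems.WidthHaldane.widthHaldane_assembly_proof` (its module imports this route file, so no `_holds` link can be stated here).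

/-! D-0027 §2.1 — DECIDING THEOREM (planner-authored via `route open/edit --closes-file`; by planner-rrepair-HubbardSuperconductivity-Width-5a408e14-0 2026-08-16T18:17:41Z):
its hypotheses are this route's items and its conclusion the sub-problem Statement (glue_lint), and it elaborates with this file. -/

@[closes "route-HubbardSuperconductivity-WidthHaldane"] theorem closes (h1 : WidthHaldaneBridge) (h2 : WidthUniformThermodynamics) :
    HubbardSuperconductivity := by
  /- CRUX-ONLY deciding theorem, no Fock-space relabelling (route-repair 2026-08-16, cone):
  (1) cruxes ⇒ the width-uniform family law `TubeFamilyLaw` (rpow monotonicity);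
  (2) the items quantify over every linearly ordered labelling `e : Λ ≃ ℤ/L × ℤ/M`, so the
  diagonal `M = L` is read DIRECTLY on `FermionTorus 2 L` with `e₀ x = (x₀, x₁)`: the tube graph
  has the adjacency of `fermionTorusGraph 2 L` (⇒ `hubbardTorus 2 L 1 U`) and the inlined column
  `d_{x²-y²}` pair operator is `localPair dWaveFormFactor L (a, b)` (`LocalPairOn.singletBond`);
  (3) the diagonal column law ⇒ pair-field LRO along even sides (`PairFieldEvenSideLRO`). -/
  have hT : TubeFamilyLaw := by
    obtain ⟨U, hU, δ, hδ, d₀, hd₀, k₀, M₁, L₀, hth⟩ := h2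
    obtain ⟨Ξ, hΞ, A, hA, R, M₂, L₁, hbr⟩ := h1 U hU δ hδ d₀ k₀ M₁ L₀ hd₀ hth
    dsimp only [TubeFamilyLaw]
    refine ⟨U, hU, δ, ⟨hδ.1, hδ.2.trans (by norm_num)⟩, Ξ * Real.sqrt (k₀ / d₀), by positivity,
      A, hA, max R 1, max M₁ M₂, max L₀ L₁, ?_⟩
    intro L M _ _ hLe hMe hM hML hL Λ _ _ e ψ hψ hGS r hr hrL
    obtain ⟨hstiff, hic0, hick⟩ :=
      hth L M hLe hMe (le_of_max_le_left hM) hML (le_of_max_le_left hL) Λ e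
    have key := hbr L M hLe hMe (le_of_max_le_right hM) hML (le_of_max_le_right hL) Λ e ψ hψ hGS
      r ((le_max_left R 1).trans hr) (le_trans (Nat.add_le_add_left (le_max_left R 1) _) hrL)
    refine le_trans ?_ key
    have hmin : (1 : ℝ) ≤ ((min r.val (L - r.val) : ℕ) : ℝ) := by
      have h1 : 1 ≤ r.val := (le_max_right R 1).trans hr
      have h2 : 1 ≤ L - r.val := by
        have := le_trans (Nat.add_le_add_left (le_max_right R 1) _) hrL
        omega
      exact_mod_cast le_min h1 h2
    have hMpos : (0 : ℝ) < (M : ℝ) := by exact_mod_cast Nat.pos_of_ne_zero (NeZero.ne M)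
    have hk₀ : 0 < k₀ := hic0.trans_le hick
    gcongr A * (L : ℝ) * (M : ℝ) ^ 2 * ?_
    apply Real.rpow_le_rpow_of_exponent_le hmin
    rw [neg_le_neg_iff]
    apply div_le_div_of_nonneg_right _ hMpos.le
    apply mul_le_mul_of_nonneg_left _ hΞ.le
    apply Real.sqrt_le_sqrt
    rw [div_le_div_iff₀ (hd₀.trans_le hstiff) hd₀]
    calc _ ≤ k₀ * d₀ := mul_le_mul_of_nonneg_right hick hd₀.le
      _ ≤ k₀ * _ := mul_le_mul_of_nonneg_left hstiff hk₀.le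
  -- (3) pair-field LRO from a column law at every large even side `n + 1` …
  obtain ⟨U, hU, δ, hδ, C, hC, A, hA, R, M₁, L₀, hTL⟩ := hT
  refine ⟨U, hU, δ, hδ, fun N ψ hE => ?_⟩
  obtain ⟨B, hB⟩ : ∃ B : ℝ, B = (∑ e ∈ insert (0 : Fin 2 → ℤ) Literature.MathematicalPhysics.QuantumLattice.unitSteps,
      ‖((Literature.MathematicalPhysics.QuantumLattice.dWaveFormFactor e / Real.sqrt 2 : ℝ) : ℂ)‖ * 2) ^ 2 := ⟨_, rfl⟩
  obtain ⟨L₂, hL₂⟩ := Literature.MathematicalPhysics.QuantumLattice.exists_half_le_rpow_neg_div C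
  refine Literature.MathematicalPhysics.QuantumLattice.hasLongRangeOrder_even_of_le Literature.MathematicalPhysics.QuantumLattice.dWaveFormFactor ψ (fun n hn => (hE (n + 1) hn).2.1)
    (by positivity : (0 : ℝ) < A / 8)
    (max (max (max L₀ M₁) L₂) ⌈8 * ((max R 1 : ℕ) : ℝ) * (A + 2 * B) / A⌉₊) ?_
  intro n hev hK
  obtain ⟨hN, hn1, hGS⟩ := hE (n + 1) hev
  rw [hN] at hGS
  simp only [max_le_iff] at hK
  obtain ⟨⟨⟨hL₀, hM₁⟩, hL₂n⟩, hK⟩ := hK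
  have hbig : 8 * ((max R 1 : ℕ) : ℝ) * (A + 2 * B) ≤ A * ((n + 1 : ℕ) : ℝ) := by
    have h1 := (Nat.le_ceil _).trans
      (show (⌈8 * ((max R 1 : ℕ) : ℝ) * (A + 2 * B) / A⌉₊ : ℝ) ≤ ((n + 1 : ℕ) : ℝ) by
        exact_mod_cast hK)
    rw [div_le_iff₀ hA] at h1
    linarith
  subst hB
  simp only [Literature.MathematicalPhysics.QuantumLattice.pairFieldCorr_succ]
  refine Literature.MathematicalPhysics.QuantumLattice.sum_pairCorr_ge_of_columnLaw (ψ (n + 1)) hn1 hA hC (le_max_right R 1)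
    (fun r hr1 hr2 => ?_) (hL₂ (n + 1) hL₂n) hbig
  -- (2) … which is the family law at `(L, M) = (n+1, n+1)` on the carrier `FermionTorus 2 (n+1)`
  obtain ⟨e₀, he₀, he₀s⟩ : ∃ e : Literature.MathematicalPhysics.QuantumLattice.FermionTorus 2 (n + 1) ≃ ZMod (n + 1) × ZMod (n + 1),
      (∀ x, e x = (Literature.MathematicalPhysics.QuantumLattice.FermionTorus.toTorusSite x 0, Literature.MathematicalPhysics.QuantumLattice.FermionTorus.toTorusSite x 1)) ∧
        ∀ p : ZMod (n + 1) × ZMod (n + 1), e.symm p = Literature.MathematicalPhysics.QuantumLattice.FermionTorus.ofTorusSite ![p.1, p.2] :=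
    ⟨Literature.MathematicalPhysics.QuantumLattice.FermionTorus.equivTorusSite.trans (finTwoArrowEquiv _), fun x => rfl, fun p => rfl⟩
  have hinj : ∀ u v : Literature.MathematicalPhysics.QuantumLattice.FermionTorus 2 (n + 1),
      Literature.MathematicalPhysics.QuantumLattice.FermionTorus.toTorusSite u = Literature.MathematicalPhysics.QuantumLattice.FermionTorus.toTorusSite v ↔ u = v := fun u v =>
    (Literature.MathematicalPhysics.QuantumLattice.FermionTorus.equivTorusSite (d := 2) (L := n + 1)).injective.eq_iff
  have hsymm : ∀ (v : Literature.MathematicalPhysics.QuantumLattice.FermionTorus 2 (n + 1)) (p : ZMod (n + 1) × ZMod (n + 1)),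
      v = e₀.symm p ↔ Literature.MathematicalPhysics.QuantumLattice.FermionTorus.toTorusSite v = ![p.1, p.2] := by
    intro v p
    rw [Equiv.eq_symm_apply, he₀, Prod.ext_iff, funext_iff, Fin.forall_fin_two]
    simp
  have hS0 : ∀ t : Fin 2 → ZMod (n + 1), t + Pi.single 0 1 = ![t 0 + 1, t 1] := fun t => by
    funext i; fin_cases i <;> simp
  have hS1 : ∀ t : Fin 2 → ZMod (n + 1), t + Pi.single 1 1 = ![t 0, t 1 + 1] := fun t => by
    funext i; fin_cases i <;> simp
  have hp1 : ∀ t : Fin 2 → ZMod (n + 1), t + Literature.Probability.LatticeModels.Torus.proj (n + 1) (Pi.single 0 1) = ![t 0 + 1, t 1] :=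
    fun t => by funext i; fin_cases i <;> simp
  have hp2 : ∀ t : Fin 2 → ZMod (n + 1), t + Literature.Probability.LatticeModels.Torus.proj (n + 1) (-Pi.single 0 1) = ![t 0 - 1, t 1] :=
    fun t => by funext i; fin_cases i <;> simp [sub_eq_add_neg]
  have hp3 : ∀ t : Fin 2 → ZMod (n + 1), t + Literature.Probability.LatticeModels.Torus.proj (n + 1) (Pi.single 1 1) = ![t 0, t 1 + 1] :=
    fun t => by funext i; fin_cases i <;> simp
  have hp4 : ∀ t : Fin 2 → ZMod (n + 1), t + Literature.Probability.LatticeModels.Torus.proj (n + 1) (-Pi.single 1 1) = ![t 0, t 1 - 1] :=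
    fun t => by funext i; fin_cases i <;> simp [sub_eq_add_neg]
  have hHc : ∀ (G₁ G₂ : SimpleGraph (Literature.MathematicalPhysics.QuantumLattice.FermionTorus 2 (n + 1))) (i₁ : DecidableRel G₁.Adj)
      (i₂ : DecidableRel G₂.Adj), (∀ x y, G₁.Adj x y ↔ G₂.Adj x y) →
      @Literature.MathematicalPhysics.QuantumLattice.hamiltonian _ _ _ G₁ i₁ 1 U = @Literature.MathematicalPhysics.QuantumLattice.hamiltonian _ _ _ G₂ i₂ 1 U := by
    intro G₁ G₂ i₁ i₂ h
    have hG : G₁ = G₂ := by ext x y; exact h x y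
    subst hG
    congr
  have hd1 : Literature.MathematicalPhysics.QuantumLattice.dWaveFormFactor (Pi.single 0 1) = 1 := if_pos (Or.inl rfl)
  have hd2 : Literature.MathematicalPhysics.QuantumLattice.dWaveFormFactor (-Pi.single 0 1) = 1 := if_pos (Or.inr rfl)
  have hd3 : Literature.MathematicalPhysics.QuantumLattice.dWaveFormFactor (Pi.single 1 1) = -1 := by
    have hne1 : (Pi.single 1 1 : Fin 2 → ℤ) ≠ Pi.single 0 1 := fun h => by simpa using congrFun h 0
    have hne2 : (Pi.single 1 1 : Fin 2 → ℤ) ≠ -Pi.single 0 1 := fun h => by simpa using congrFun h 0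
    rw [Literature.MathematicalPhysics.QuantumLattice.dWaveFormFactor, if_neg (not_or.2 ⟨hne1, hne2⟩), if_pos (Or.inl rfl)]
  have hd4 : Literature.MathematicalPhysics.QuantumLattice.dWaveFormFactor (-Pi.single 1 1) = -1 := by
    have hne3 : (-Pi.single 1 1 : Fin 2 → ℤ) ≠ Pi.single 0 1 := fun h => by simpa using congrFun h 0
    have hne4 : (-Pi.single 1 1 : Fin 2 → ℤ) ≠ -Pi.single 0 1 := fun h => by simpa using congrFun h 1
    rw [Literature.MathematicalPhysics.QuantumLattice.dWaveFormFactor, if_neg (not_or.2 ⟨hne3, hne4⟩), if_pos (Or.inr rfl)]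
  have hsum : ∀ {β : Type} [AddCommMonoid β] (f : (Fin 2 → ℤ) → β), ∑ e ∈ Literature.MathematicalPhysics.QuantumLattice.unitSteps, f e =
      f (Pi.single 0 1) + f (-Pi.single 0 1) + f (Pi.single 1 1) + f (-Pi.single 1 1) := by
    intro β _ f
    have h1 : (Pi.single 0 1 : Fin 2 → ℤ) ∉
        ({-Pi.single 0 1, Pi.single 1 1, -Pi.single 1 1} : Finset (Fin 2 → ℤ)) := by
      simp only [Finset.mem_insert, Finset.mem_singleton]; decide
    have h2 : (-Pi.single 0 1 : Fin 2 → ℤ) ∉ ({Pi.single 1 1, -Pi.single 1 1} : Finset (Fin 2 → ℤ)) := by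
      simp only [Finset.mem_insert, Finset.mem_singleton]; decide
    have h3 : (Pi.single 1 1 : Fin 2 → ℤ) ∉ ({-Pi.single 1 1} : Finset (Fin 2 → ℤ)) := by
      simp only [Finset.mem_singleton]; decide
    rw [Literature.MathematicalPhysics.QuantumLattice.unitSteps, Finset.sum_insert h1, Finset.sum_insert h2, Finset.sum_insert h3,
      Finset.sum_singleton]
    abel
  have key := hTL (n + 1) (n + 1) hev hev hM₁ le_rfl hL₀ (Literature.MathematicalPhysics.QuantumLattice.FermionTorus 2 (n + 1)) e₀ (ψ (n + 1)) hn1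
  convert key ?gs r ((le_max_left R 1).trans hr1)
    (le_trans (Nat.add_le_add_left (le_max_left R 1) _) hr2) using 1
  case gs =>
    dsimp only
    convert hGS using 2
    · rw [Literature.MathematicalPhysics.QuantumLattice.hubbardTorus]
      refine hHc _ _ _ _ fun x y => ?_
      simp only [SimpleGraph.fromRel_adj, Literature.MathematicalPhysics.QuantumLattice.fermionTorusGraph_adj, Literature.Probability.LatticeModels.torusGraph_adj_iff,
        Fin.exists_fin_two, hsymm, he₀, hS0, hS1, ne_eq, hinj]
    · simp only [sq]
  · ring
  · simp only [Fin.sum_univ_four, Matrix.cons_val_zero, Matrix.cons_val_one, Matrix.cons_val,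
      Equiv.apply_symm_apply]
    simp only [he₀s]
    refine Finset.sum_congr rfl fun a _ => ?_
    rw [Matrix.conjTranspose_sum, Finset.sum_mul]
    simp only [Finset.mul_sum, Literature.MathematicalPhysics.QuantumLattice.expect_sum, Complex.re_sum]
    refine Finset.sum_congr rfl fun b _ => Finset.sum_congr rfl fun b' _ => ?_
    simp only [Literature.MathematicalPhysics.QuantumLattice.localPair_dWave_eq_localPairOn_unitSteps, Literature.MathematicalPhysics.QuantumLattice.localPairOn_eq_sum_singletBond, hsum,
      Literature.MathematicalPhysics.QuantumLattice.singletBond, hd1, hd2, hd3, hd4, hp1, hp2, hp3, hp4, Matrix.cons_val_zero,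
      Matrix.cons_val_one]

end Summit.HubbardSuperconductivity.HubbardSuperconductivity.Theses.WidthHaldane
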